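import Literature.Barriers.CriticalPhenomena.WeaklySAWPerturbativeEtaTheta
import HarnessLib

/-!
# BBS 2015, §6.1: the perturbative map `φ_pt^{(0)}`, the change of variables `T_j`, and the identity
# `T_{j+1} ∘ φ_pt^{(0)} = φ̄_j ∘ T_j + (cubic)` ([BBS-rg-pt, Proposition 4.2.1], algebraic part)

Source: Bauerschmidt–Brydges–Slade, CMP 337 (2015) [BBS2015], §6.1: "In [BBS-rg-pt], an explicit
quadratic map `φ_{pt,j}^{(0)} : ℝ³ → ℝ³` is defined … In [BBS-rg-pt], we define quadratic polynomials
`T_j : ℝ³ → ℝ³` and consider the change of variables `V_j ↦ V̌_j = T_j(V_j)`. The transformation `T_j`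
satisfies `T_0(V) = V`, `T_j(V) = V + O(‖V‖²)`, with error estimate uniform in `j`. … The composite maps
`T_{j+1} ∘ φ_{pt,j}^{(0)} ∘ T_j⁻¹` are equal, up to an error `O(‖V‖³)`, to `φ̄_j`", with [BBS-rg-pt] =
Bauerschmidt–Brydges–Slade, *A renormalisation group method. III. Perturbative analysis*, J. Stat.
Phys. 159 (2015), arXiv:1403.7252: §4.2, displays (wbardef1)–(wbardef2) ("`μ_j = L^{2j}ν_j`,
`ω_j = L²¼β_j`, `γ_j = L^{2(j+1)}γ'_j` (`γ = η, ξ, π`), `w̄_j^{(1)} = L^{-2j}w_j^{(1)}`,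
`w̄_j^{(**)} = L^{-4j}w_j^{(**)}`"), (newflow-g)–(newflow-mu) (the map `φ_pt^{(0)}` on `ℝ³`),
(gch-def1)–(much-def1) ("`ǧ = g + 4gμw̄_j^{(1)}`, `ž = z + 2zμw̄_j^{(1)} + ½μ²w̄_j^{(**)}`,
`μ̌ = μ + μ²w̄_j^{(1)}`"), Proposition 4.2.1 ("`T_{j+1} ∘ φ_{pt,j}^{(0)} = φ̄_j ∘ T_j + ρ_{pt,j} ∘ T_j`,
`T_j(V) = V + O(|V|²)` … `ρ_{pt,j}(V) = O((1+m²L^{2j})^{-k}|V|³)`"), and its proof in §6.2: "Let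
`μ₊ = L^{2(j+1)}ν₊`. By (delta-def), (newflow-g)–(newflow-mu) are equivalent to
`[g_pt + 4gμ₊w̄_{j+1}^{(1)}] = [g + 4gμw̄_j^{(1)}] - β_jg²`,
`[z_pt + 2zμ₊w̄_{j+1}^{(1)} + ½μ₊²w̄_{j+1}^{(**)}] = [z + 2zμw̄_j^{(1)} + ½μ²w̄_j^{(**)}] - θ_jg²`,
`[μ_pt + μ₊²w̄_{j+1}^{(1)}] = L²[μ + μ²w̄_j^{(1)}] + η_j[g + 4gμw̄_j^{(1)}] - ξ_jg² - ω_jgμ - π_jgz`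
… The left-hand sides equal `T_{j+1}(φ_{pt,j}^{(0)}(V)) + O((1+m²L^{2j})^{-k}|V|³)` and the right-hand
sides are equal to `φ̄_j(T_j(V)) + O((1+m²L^{2j})^{-k}|V|³)`."

## What this file provides (definitions with bodies; everything else proved; no named fact)

All for the explicit decomposition `C_j = LongRangePhi4.FRD.Gam d L m² j` of this tree, `w_j = Σ_{i≤j}C_i`
(`covSum`), in `d = 4` for the bounds:
* `wbarOne d L m² j` — `w̄_j^{(1)} = L^{-2j}Σ_xw_{j,x}`; `wbarStar d L m² j` — `w̄_j^{(**)} =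
  L^{-4j}(w_j)^{(**)}` (with the rotation-averaged `starSum` of `WeaklySAWPerturbativeCoefficients`);
  `wbarOneDiff`, `wbarStarDiff` — `L²w̄_{j+1}^{(1)} - w̄_j^{(1)} = L^{-2j}C_{j+1}^{(1)}` and
  `L⁴w̄_{j+1}^{(**)} - w̄_j^{(**)} = L^{-4j}C_{j+1}^{(**)}` (`wbarOneDiff_eq`, `wbarStarDiff_eq`), the two
  combinations through which `w̄` enters the cubic remainder;
* the uniform bounds of [BBS-rg-pt, Lemma 6.1.2] in rescaled form: `|w̄_j^{(1)}| ≤ WL⁴`,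
  `|w̄_j^{(**)}| ≤ WL⁶` for ALL `j` and ALL `m² ≥ 0` (`abs_wbarOne_le`, `abs_wbarStar_le` — "the constants
  in (wbardef1)–(wbardef2) are all uniformly bounded"), and `|L^{-2j}C_{j+1}^{(1)}| ≤ WL⁴ϑ_j`,
  `|L^{-4j}C_{j+1}^{(**)}| ≤ WL⁶ϑ_j` with the decay factor `ϑ_j(m²;p) = ((1+L^{2j}m²/(8+m²))^p)⁻¹` of
  `WeaklySAWPerturbativeBetaMassDecay` (`abs_wbarOneDiff_le(_decay)`, `abs_wbarStarDiff_le(_decay)`);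
* `Ttrans L m² j : V3 → V3` — the printed `T_j` on `𝒱 = ℝ³` (coordinates `V 0 = g`, `V 1 = z`, `V 2 = μ`
  of `WeaklySAWFlowStructuralStability`); **`Ttrans_zero_scale`** (`T_0(V) = V`) and
  **`norm_Ttrans_sub_self_le`**, **`exists_norm_Ttrans_sub_self_le`** (`‖T_j(V) - V‖ ≤ A‖V‖²` with `A`
  uniform in `j` and `m² ≥ 0`) — the display of BBS 2015 §6.1;
* `muPlus` (`μ₊ = L²μ + η_jg`), `phiPT L m² j : V3 → V3` — `φ_{pt,j}^{(0)}` ((newflow-g)–(newflow-mu)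
  written out through the §6.2 brackets; `phiPT_bracket_zero/one/two` ARE the three displayed bracket
  identities); `phiPTnu` — the unrescaled bulk flow (gpt2a), (nupta), (zpta) of [BBS-rg-pt] (`y = 0`,
  `z = z^{(0)}`) with `phiPT_rescale`: `φ_pt^{(0)}(g, z, L^{2j}ν) = (g_pt, z_pt, L^{2(j+1)}ν_pt)`;
* `rhoPT L m² j := T_{j+1} ∘ φ_{pt,j}^{(0)} - φ̄_j ∘ T_j` (`φ̄_j = (wsawQuadFlow L m²).map j`) and the
  **second-order cancellation** `rhoPT_apply_zero/one/two`: each component of `rhoPT` is an explicit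
  polynomial in `(g, z, μ)` with NO terms of degree `< 3`, every monomial carrying one of the decaying
  factors `β_j, θ_j, η_j, ξ_j, ω_j, π_j, L^{-2j}C_{j+1}^{(1)}, L^{-4j}C_{j+1}^{(**)}` — the identities
  behind "the left-hand sides equal `T_{j+1}(φ_pt(V)) + O(|V|³)` and the right-hand sides
  `φ̄_j(T_j(V)) + O(|V|³)`". The quantitative cubic bound and the inverse `T_j⁻¹` are in the sequel
  `WeaklySAWPerturbativeTransformationBounds.lean`.
-/

noncomputable section

open Set Filter Topology
open Literature.Probability.LatticeModels
open scoped BigOperators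

namespace Literature.Barriers.CriticalPhenomena

namespace CTWSAW

open LongRangePhi4 LongRangePhi4.FRD PT

variable {d : ℕ}

/-! ### `w̄_j^{(1)}`, `w̄_j^{(**)}` -/

/-- **`w̄_j^{(1)} = L^{-2j}w_j^{(1)} = L^{-2j}Σ_{x∈ℤ^d}w_{j,x}`**.
[cite: BauerschmidtBrydgesSlade2015LogCorr, §6.1 (T_j "defined in [BBS-rg-pt]": [BBS-rg-pt] §4.2 (wbardef2) and §3.6 (wndef) q^{(1)} = Σ_xq_{0,x})] -/
def wbarOne (d : ℕ) (L s : ℝ) (j : ℕ) : ℝ := (L ^ (2 * j))⁻¹ * ∑' x : Site d, covSum d L s j x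

/-- **`w̄_j^{(**)} = L^{-4j}w_j^{(**)}`** (with `q^{(**)}` in the rotation-averaged form `starSum`).
[cite: BauerschmidtBrydgesSlade2015LogCorr, §6.1 ([BBS-rg-pt] §4.2 (wbardef2), §3.6 (wndef))] -/
def wbarStar (d : ℕ) (L s : ℝ) (j : ℕ) : ℝ := (L ^ (4 * j))⁻¹ * starSum (covSum d L s j)

/-- `L²w̄_{j+1}^{(1)} - w̄_j^{(1)}` (`= L^{-2j}C_{j+1}^{(1)}`, `wbarOneDiff_eq`).
[cite: BauerschmidtBrydgesSlade2015LogCorr, §6.1 ([BBS-rg-pt] §6.2, proof of Proposition 4.2.1)] -/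
def wbarOneDiff (d : ℕ) (L s : ℝ) (j : ℕ) : ℝ := L ^ 2 * wbarOne d L s (j + 1) - wbarOne d L s j

/-- `L⁴w̄_{j+1}^{(**)} - w̄_j^{(**)}` (`= L^{-4j}C_{j+1}^{(**)}`, `wbarStarDiff_eq`).
[cite: BauerschmidtBrydgesSlade2015LogCorr, §6.1 ([BBS-rg-pt] §6.2, proof of Proposition 4.2.1)] -/
def wbarStarDiff (d : ℕ) (L s : ℝ) (j : ℕ) : ℝ := L ^ 4 * wbarStar d L s (j + 1) - wbarStar d L s j

/-- `Σ_xw_{j,x}` is a finite sum over any ball `|x|₁ < R`, `R ≥ ½L^j`. [cite: BauerschmidtBrydgesSlade2015LogCorr, §5.1 (finite range)] -/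
theorem tsum_covSum_eq_sum (hd : 1 ≤ d) {L : ℝ} (hL : 1 ≤ L) {s : ℝ} (hs : 0 ≤ s) (j : ℕ) {R : ℝ}
    (hR : L ^ j / 2 ≤ R) :
    ∑' x : Site d, covSum d L s j x = ∑ x ∈ PT.ball R, covSum d L s j x := by
  refine tsum_eq_sum fun x hx => ?_
  rw [PT.mem_ball, not_lt] at hx
  exact covSum_eq_zero hd hL hs (hR.trans hx)

/-- `(w_j)^{(**)}` is a finite sum over any ball `|x|₁ < R`, `R ≥ ½L^j`. [cite: BauerschmidtBrydgesSlade2015LogCorr, §5.1 (finite range)] -/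
theorem starSum_covSum_eq_sum (hd : 1 ≤ d) {L : ℝ} (hL : 1 ≤ L) {s : ℝ} (hs : 0 ≤ s) (j : ℕ) {R : ℝ}
    (hR : L ^ j / 2 ≤ R) :
    starSum (covSum d L s j) = (∑ x ∈ PT.ball R, (∑ i, ((x i : ℤ) : ℝ) ^ 2) * covSum d L s j x) / d := by
  refine starSum_eq_sum fun x hx => ?_
  rw [PT.mem_ball, not_lt] at hx
  exact covSum_eq_zero hd hL hs (hR.trans hx)

/-- `Σ_xC_{j+1;0,x}` is a finite sum over any ball `|x|₁ < R`, `R ≥ ½L^{j+1}`. [cite: BauerschmidtBrydgesSlade2015LogCorr, §5.1 (finite range)] -/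
theorem tsum_Gam_eq_sum (hd : 1 ≤ d) {L : ℝ} (hL : 0 ≤ L) {s : ℝ} (hs : 0 ≤ s) (j : ℕ) {R : ℝ}
    (hR : L ^ j / 2 ≤ R) :
    ∑' x : Site d, Gam d L s j x = ∑ x ∈ PT.ball R, Gam d L s j x := by
  refine tsum_eq_sum fun x hx => ?_
  rw [PT.mem_ball, not_lt] at hx
  exact Gam_eq_zero hd hL hs j x (hR.trans hx)

/-- `w̄_0^{(1)} = 0` (`w_0 = 0`). [cite: BauerschmidtBrydgesSlade2015LogCorr, §6.1 (w_{j,x} = Σ_{i=1}^jC_{i;0,x})] -/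
@[simp] theorem wbarOne_zero_scale (d : ℕ) (L s : ℝ) : wbarOne d L s 0 = 0 := by
  simp [wbarOne]

/-- `w̄_0^{(**)} = 0` (`w_0 = 0`). [cite: BauerschmidtBrydgesSlade2015LogCorr, §6.1 (w_{j,x} = Σ_{i=1}^jC_{i;0,x})] -/
@[simp] theorem wbarStar_zero_scale (d : ℕ) (L s : ℝ) : wbarStar d L s 0 = 0 := by
  simp [wbarStar, starSum]

/-- **`L²w̄_{j+1}^{(1)} - w̄_j^{(1)} = L^{-2j}C_{j+1}^{(1)} = L^{-2j}Σ_{|x|₁<½L^{j+1}}C_{j+1;0,x}`**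
(`d ≥ 1`, `L ≥ 1`, `m² ≥ 0`). [cite: BauerschmidtBrydgesSlade2015LogCorr, §6.1 ([BBS-rg-pt] §3.6: w₊ = w + C, and §6.2)] -/
theorem wbarOneDiff_eq (hd : 1 ≤ d) {L : ℝ} (hL : 1 ≤ L) {s : ℝ} (hs : 0 ≤ s) (j : ℕ) :
    wbarOneDiff d L s j = (L ^ (2 * j))⁻¹ * ∑ x ∈ PT.ball (L ^ (j + 1) / 2), Gam d L s (j + 1) x := by
  have hL0 : (0 : ℝ) < L := by linarith
  have hR : L ^ j / 2 ≤ L ^ (j + 1) / 2 :=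
    div_le_div_of_nonneg_right (pow_le_pow_right₀ hL (Nat.le_succ j)) (by norm_num)
  unfold wbarOneDiff wbarOne
  rw [tsum_covSum_eq_sum hd hL hs (j + 1) le_rfl, tsum_covSum_eq_sum hd hL hs j hR]
  set A := ∑ x ∈ PT.ball (L ^ (j + 1) / 2), covSum d L s j x with hA
  set B := ∑ x ∈ PT.ball (L ^ (j + 1) / 2), Gam d L s (j + 1) x with hB
  have e1 : ∑ x ∈ PT.ball (L ^ (j + 1) / 2), covSum d L s (j + 1) x = A + B := by
    rw [hA, hB, ← Finset.sum_add_distrib]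
    exact Finset.sum_congr rfl fun x _ => covSum_succ L s j x
  have h2 : (L ^ (2 * (j + 1)))⁻¹ = (L ^ (2 * j))⁻¹ * (L ^ 2)⁻¹ := by
    rw [← mul_inv, ← pow_add]; ring_nf
  rw [e1, h2]
  have hL2 : L ^ 2 * (L ^ 2)⁻¹ = 1 := mul_inv_cancel₀ (pow_ne_zero _ hL0.ne')
  linear_combination (L ^ (2 * j))⁻¹ * (A + B) * hL2

/-- **`L⁴w̄_{j+1}^{(**)} - w̄_j^{(**)} = L^{-4j}C_{j+1}^{(**)}`** (finite sum over `|x|₁ < ½L^{j+1}`;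
`d ≥ 1`, `L ≥ 1`, `m² ≥ 0`). [cite: BauerschmidtBrydgesSlade2015LogCorr, §6.1 ([BBS-rg-pt] §3.6: w₊ = w + C, and §6.2)] -/
theorem wbarStarDiff_eq (hd : 1 ≤ d) {L : ℝ} (hL : 1 ≤ L) {s : ℝ} (hs : 0 ≤ s) (j : ℕ) :
    wbarStarDiff d L s j = (L ^ (4 * j))⁻¹ *
      ((∑ x ∈ PT.ball (L ^ (j + 1) / 2), (∑ i, ((x i : ℤ) : ℝ) ^ 2) * Gam d L s (j + 1) x) / d) := by
  have hL0 : (0 : ℝ) < L := by linarith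
  have hR : L ^ j / 2 ≤ L ^ (j + 1) / 2 :=
    div_le_div_of_nonneg_right (pow_le_pow_right₀ hL (Nat.le_succ j)) (by norm_num)
  unfold wbarStarDiff wbarStar
  rw [starSum_covSum_eq_sum hd hL hs (j + 1) le_rfl, starSum_covSum_eq_sum hd hL hs j hR]
  set A := ∑ x ∈ PT.ball (L ^ (j + 1) / 2), (∑ i, ((x i : ℤ) : ℝ) ^ 2) * covSum d L s j x with hA
  set B := ∑ x ∈ PT.ball (L ^ (j + 1) / 2), (∑ i, ((x i : ℤ) : ℝ) ^ 2) * Gam d L s (j + 1) x with hB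
  have e1 : ∑ x ∈ PT.ball (L ^ (j + 1) / 2), (∑ i, ((x i : ℤ) : ℝ) ^ 2) * covSum d L s (j + 1) x =
      A + B := by
    rw [hA, hB, ← Finset.sum_add_distrib]
    exact Finset.sum_congr rfl fun x _ => by rw [covSum_succ]; ring
  have h2 : (L ^ (4 * (j + 1)))⁻¹ = (L ^ (4 * j))⁻¹ * (L ^ 4)⁻¹ := by
    rw [← mul_inv, ← pow_add]; ring_nf
  rw [e1, h2]
  have hL4 : L ^ 4 * (L ^ 4)⁻¹ = 1 := mul_inv_cancel₀ (pow_ne_zero _ hL0.ne')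
  linear_combination (L ^ (4 * j))⁻¹ * ((A + B) / d) * hL4

/-! ### Uniform bounds (`d = 4`) -/

/-- **`|w̄_j^{(1)}| ≤ WL⁴` for all `j` and all `m² ≥ 0`** (`L ≥ 2`): `w_j^{(1)} = O(L^{2j})`
([BBS-rg-pt, Lemma 6.1.2], here from `|C_{i+1;0,x}| ≤ cL^{-2i}𝟙{|x|₁<½L^{i+1}}` and counting).
[cite: BauerschmidtBrydgesSlade2015LogCorr, §6.1 ("T_j(V) = V + O(‖V‖²) with error estimate uniform in j"; [BBS-rg-pt] Lemma 6.1.2, w_j^{(1)} = O(L^{2j}))] -/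
theorem abs_wbarOne_le : ∃ W : ℝ, 0 < W ∧ ∀ L : ℝ, 2 ≤ L → ∀ s : ℝ, 0 ≤ s → ∀ j : ℕ,
    |wbarOne 4 L s j| ≤ W * L ^ 4 := by
  obtain ⟨c, hc, h⟩ := abs_Gam_four_le
  refine ⟨32 * c, by positivity, fun L hL s hs j => ?_⟩
  classical
  have hL1 : (1 : ℝ) ≤ L := by linarith
  have hL0 : (0 : ℝ) < L := by linarith
  set S := PT.ball (d := 4) (L ^ j / 2) with hS
  have hsum : |∑' x : Site 4, covSum 4 L s j x| ≤ 32 * c * L ^ 4 * L ^ (2 * j) := by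
    rw [tsum_covSum_eq_sum (by norm_num) hL1 hs j le_rfl]
    calc |∑ x ∈ S, covSum 4 L s j x| ≤ ∑ x ∈ S, |covSum 4 L s j x| := Finset.abs_sum_le_sum_abs _ _
      _ ≤ ∑ x ∈ S, ∑ i ∈ Finset.range j,
            c / L ^ (2 * i) * (if x ∈ PT.ball (L ^ (i + 1) / 2) then (1 : ℝ) else 0) :=
          Finset.sum_le_sum fun x _ => abs_covSum_four_le h hL hs j x
      _ = ∑ i ∈ Finset.range j, c / L ^ (2 * i) *
            ∑ x ∈ S, (if x ∈ PT.ball (L ^ (i + 1) / 2) then (1 : ℝ) else 0) := by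
          rw [Finset.sum_comm]
          exact Finset.sum_congr rfl fun i _ => by rw [Finset.mul_sum]
      _ ≤ ∑ i ∈ Finset.range j, c / L ^ (2 * i) * (16 * L ^ 4 * L ^ (4 * i)) :=
          Finset.sum_le_sum fun i _ =>
            mul_le_mul_of_nonneg_left (sum_ball_indicator_le S hL1 i) (by positivity)
      _ = 16 * c * L ^ 4 * ∑ i ∈ Finset.range j, L ^ (2 * i) := by
          rw [Finset.mul_sum]
          refine Finset.sum_congr rfl fun i _ => ?_
          have hLi : L ^ (2 * i) ≠ 0 := pow_ne_zero _ hL0.ne'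
          have e4 : L ^ (4 * i) = L ^ (2 * i) * L ^ (2 * i) := by rw [← pow_add]; ring_nf
          rw [e4, div_eq_mul_inv]
          calc c * (L ^ (2 * i))⁻¹ * (16 * L ^ 4 * (L ^ (2 * i) * L ^ (2 * i))) =
                c * 16 * L ^ 4 * ((L ^ (2 * i))⁻¹ * L ^ (2 * i)) * L ^ (2 * i) := by ring
            _ = 16 * c * L ^ 4 * L ^ (2 * i) := by rw [inv_mul_cancel₀ hLi]; ring
      _ ≤ 16 * c * L ^ 4 * (2 * L ^ (2 * j)) :=
          mul_le_mul_of_nonneg_left (geom_sum_sq_le hL j) (by positivity)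
      _ = 32 * c * L ^ 4 * L ^ (2 * j) := by ring
  unfold wbarOne
  rw [abs_mul, abs_inv, abs_of_pos (by positivity : (0 : ℝ) < L ^ (2 * j))]
  have hLj : L ^ (2 * j) ≠ 0 := pow_ne_zero _ hL0.ne'
  calc (L ^ (2 * j))⁻¹ * |∑' x : Site 4, covSum 4 L s j x|
      ≤ (L ^ (2 * j))⁻¹ * (32 * c * L ^ 4 * L ^ (2 * j)) := mul_le_mul_of_nonneg_left hsum (by positivity)
    _ = 32 * c * L ^ 4 * ((L ^ (2 * j))⁻¹ * L ^ (2 * j)) := by ring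
    _ = 32 * c * L ^ 4 := by rw [inv_mul_cancel₀ hLj, mul_one]

/-- **`|w̄_j^{(**)}| ≤ WL⁶` for all `j` and all `m² ≥ 0`** (`L ≥ 2`): `w_j^{(**)} = O(L^{4j})`
([BBS-rg-pt, Lemma 6.1.2], from `|x|₂² ≤ |x|₁² < ¼L^{2(i+1)}` on the support of `C_{i+1}`).
[cite: BauerschmidtBrydgesSlade2015LogCorr, §6.1 ("uniform in j"; [BBS-rg-pt] Lemma 6.1.2, w_j^{(**)} = O(L^{4j}))] -/
theorem abs_wbarStar_le : ∃ W : ℝ, 0 < W ∧ ∀ L : ℝ, 2 ≤ L → ∀ s : ℝ, 0 ≤ s → ∀ j : ℕ,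
    |wbarStar 4 L s j| ≤ W * L ^ 6 := by
  obtain ⟨c, hc, h⟩ := abs_Gam_four_le
  refine ⟨c, hc, fun L hL s hs j => ?_⟩
  classical
  have hL1 : (1 : ℝ) ≤ L := by linarith
  have hL0 : (0 : ℝ) < L := by linarith
  set S := PT.ball (d := 4) (L ^ j / 2) with hS
  have hsum : |∑ x ∈ S, (∑ i, ((x i : ℤ) : ℝ) ^ 2) * covSum 4 L s j x| ≤ 4 * c * L ^ 6 * L ^ (4 * j) := by
    calc |∑ x ∈ S, (∑ i, ((x i : ℤ) : ℝ) ^ 2) * covSum 4 L s j x|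
        ≤ ∑ x ∈ S, |(∑ i, ((x i : ℤ) : ℝ) ^ 2) * covSum 4 L s j x| := Finset.abs_sum_le_sum_abs _ _
      _ ≤ ∑ x ∈ S, (((∑ i, (x i).natAbs : ℕ) : ℝ)) ^ 2 * ∑ i ∈ Finset.range j,
            c / L ^ (2 * i) * (if x ∈ PT.ball (L ^ (i + 1) / 2) then (1 : ℝ) else 0) := by
          refine Finset.sum_le_sum fun x _ => ?_
          rw [abs_mul, abs_of_nonneg (Finset.sum_nonneg fun i _ => sq_nonneg _)]
          exact mul_le_mul (sq_coords_le_l1_sq x) (abs_covSum_four_le h hL hs j x) (abs_nonneg _)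
            (by positivity)
      _ = ∑ i ∈ Finset.range j, c / L ^ (2 * i) * ∑ x ∈ S, (((∑ i, (x i).natAbs : ℕ) : ℝ)) ^ 2 *
            (if x ∈ PT.ball (L ^ (i + 1) / 2) then (1 : ℝ) else 0) := by
          simp_rw [Finset.mul_sum]
          rw [Finset.sum_comm]
          exact Finset.sum_congr rfl fun i _ => Finset.sum_congr rfl fun x _ => by ring
      _ ≤ ∑ i ∈ Finset.range j, c / L ^ (2 * i) * (4 * L ^ 6 * L ^ (6 * i)) :=
          Finset.sum_le_sum fun i _ =>
            mul_le_mul_of_nonneg_left (sum_l1_sq_ind_le S hL1 i) (by positivity)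
      _ = 4 * c * L ^ 6 * ∑ i ∈ Finset.range j, L ^ (4 * i) := by
          rw [Finset.mul_sum]
          refine Finset.sum_congr rfl fun i _ => ?_
          have hLi : L ^ (2 * i) ≠ 0 := pow_ne_zero _ hL0.ne'
          have e6 : L ^ (6 * i) = L ^ (2 * i) * L ^ (4 * i) := by rw [← pow_add]; ring_nf
          rw [e6, div_eq_mul_inv]
          calc c * (L ^ (2 * i))⁻¹ * (4 * L ^ 6 * (L ^ (2 * i) * L ^ (4 * i))) =
                c * 4 * L ^ 6 * ((L ^ (2 * i))⁻¹ * L ^ (2 * i)) * L ^ (4 * i) := by ring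
            _ = 4 * c * L ^ 6 * L ^ (4 * i) := by rw [inv_mul_cancel₀ hLi]; ring
      _ ≤ 4 * c * L ^ 6 * L ^ (4 * j) :=
          mul_le_mul_of_nonneg_left (geom_sum_four_le_pow hL j) (by positivity)
  unfold wbarStar
  rw [starSum_covSum_eq_sum (by norm_num) hL1 hs j le_rfl, abs_mul, abs_inv,
    abs_of_pos (by positivity : (0 : ℝ) < L ^ (4 * j)), abs_div]
  have hLj : L ^ (4 * j) ≠ 0 := pow_ne_zero _ hL0.ne'
  rw [show |((4 : ℕ) : ℝ)| = 4 by norm_num]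
  calc (L ^ (4 * j))⁻¹ * (|∑ x ∈ S, (∑ i, ((x i : ℤ) : ℝ) ^ 2) * covSum 4 L s j x| / 4)
      ≤ (L ^ (4 * j))⁻¹ * (4 * c * L ^ 6 * L ^ (4 * j) / 4) := by gcongr
    _ = c * L ^ 6 * ((L ^ (4 * j))⁻¹ * L ^ (4 * j)) := by ring
    _ = c * L ^ 6 := by rw [inv_mul_cancel₀ hLj, mul_one]

/-- The generic estimate behind the two difference bounds: if `|C_{j+1;0,x}| ≤ a` for all `x`, then
`|L²w̄_{j+1}^{(1)} - w̄_j^{(1)}| ≤ 16L⁴L^{2j}a` (`#{|x|₁ < ½L^{j+1}} ≤ 16L⁴L^{4j}`).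
[cite: BauerschmidtBrydgesSlade2015LogCorr, §6.1 ([BBS-rg-pt] Lemma 6.1.2, proof)] -/
theorem abs_wbarOneDiff_le_core {L : ℝ} (hL : 2 ≤ L) {s : ℝ} (hs : 0 ≤ s) (j : ℕ) {a : ℝ}
    (ha : ∀ x : Site 4, |Gam 4 L s (j + 1) x| ≤ a) :
    |wbarOneDiff 4 L s j| ≤ 16 * L ^ 4 * L ^ (2 * j) * a := by
  classical
  have hL1 : (1 : ℝ) ≤ L := by linarith
  have hL0 : (0 : ℝ) < L := by linarith
  have ha0 : 0 ≤ a := (abs_nonneg _).trans (ha 0)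
  set S := PT.ball (d := 4) (L ^ (j + 1) / 2) with hS
  rw [wbarOneDiff_eq (by norm_num) hL1 hs j, abs_mul, abs_inv,
    abs_of_pos (by positivity : (0 : ℝ) < L ^ (2 * j))]
  have hcard : (S.card : ℝ) ≤ 16 * L ^ 4 * L ^ (4 * j) := card_ball_four_le hL1 j
  have hsum : |∑ x ∈ S, Gam 4 L s (j + 1) x| ≤ 16 * L ^ 4 * L ^ (4 * j) * a := by
    calc |∑ x ∈ S, Gam 4 L s (j + 1) x| ≤ ∑ x ∈ S, |Gam 4 L s (j + 1) x| :=
          Finset.abs_sum_le_sum_abs _ _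
      _ ≤ ∑ x ∈ S, a := Finset.sum_le_sum fun x _ => ha x
      _ = S.card * a := by rw [Finset.sum_const, nsmul_eq_mul]
      _ ≤ 16 * L ^ 4 * L ^ (4 * j) * a := mul_le_mul_of_nonneg_right hcard ha0
  have hLj : L ^ (2 * j) ≠ 0 := pow_ne_zero _ hL0.ne'
  have e4 : L ^ (4 * j) = L ^ (2 * j) * L ^ (2 * j) := by rw [← pow_add]; ring_nf
  calc (L ^ (2 * j))⁻¹ * |∑ x ∈ S, Gam 4 L s (j + 1) x|
      ≤ (L ^ (2 * j))⁻¹ * (16 * L ^ 4 * L ^ (4 * j) * a) := mul_le_mul_of_nonneg_left hsum (by positivity)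
    _ = 16 * L ^ 4 * ((L ^ (2 * j))⁻¹ * L ^ (2 * j)) * L ^ (2 * j) * a := by rw [e4]; ring
    _ = 16 * L ^ 4 * L ^ (2 * j) * a := by rw [inv_mul_cancel₀ hLj, mul_one]

/-- The generic estimate behind the `(**)`-difference bounds: if `|C_{j+1;0,x}| ≤ a` for all `x`, then
`|L⁴w̄_{j+1}^{(**)} - w̄_j^{(**)}| ≤ L⁶L^{2j}a` (`Σ_{|x|₁<½L^{j+1}}|x|₁² ≤ 4L⁶L^{6j}`, `d = 4`).
[cite: BauerschmidtBrydgesSlade2015LogCorr, §6.1 ([BBS-rg-pt] Lemma 6.1.2, proof)] -/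
theorem abs_wbarStarDiff_le_core {L : ℝ} (hL : 2 ≤ L) {s : ℝ} (hs : 0 ≤ s) (j : ℕ) {a : ℝ}
    (ha : ∀ x : Site 4, |Gam 4 L s (j + 1) x| ≤ a) :
    |wbarStarDiff 4 L s j| ≤ L ^ 6 * L ^ (2 * j) * a := by
  classical
  have hL1 : (1 : ℝ) ≤ L := by linarith
  have hL0 : (0 : ℝ) < L := by linarith
  have ha0 : 0 ≤ a := (abs_nonneg _).trans (ha 0)
  set S := PT.ball (d := 4) (L ^ (j + 1) / 2) with hS
  rw [wbarStarDiff_eq (by norm_num) hL1 hs j, abs_mul, abs_inv,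
    abs_of_pos (by positivity : (0 : ℝ) < L ^ (4 * j)), abs_div,
    show |((4 : ℕ) : ℝ)| = 4 by norm_num]
  have hsum : |∑ x ∈ S, (∑ i, ((x i : ℤ) : ℝ) ^ 2) * Gam 4 L s (j + 1) x| ≤ 4 * L ^ 6 * L ^ (6 * j) * a := by
    calc |∑ x ∈ S, (∑ i, ((x i : ℤ) : ℝ) ^ 2) * Gam 4 L s (j + 1) x|
        ≤ ∑ x ∈ S, |(∑ i, ((x i : ℤ) : ℝ) ^ 2) * Gam 4 L s (j + 1) x| := Finset.abs_sum_le_sum_abs _ _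
      _ ≤ ∑ x ∈ S, (((∑ i, (x i).natAbs : ℕ) : ℝ)) ^ 2 *
            (if x ∈ PT.ball (L ^ (j + 1) / 2) then (1 : ℝ) else 0) * a := by
          refine Finset.sum_le_sum fun x hx => ?_
          rw [abs_mul, abs_of_nonneg (Finset.sum_nonneg fun i _ => sq_nonneg _),
            if_pos (show x ∈ PT.ball (L ^ (j + 1) / 2) from hx), mul_one]
          exact mul_le_mul (sq_coords_le_l1_sq x) (ha x) (abs_nonneg _) (by positivity)
      _ = (∑ x ∈ S, (((∑ i, (x i).natAbs : ℕ) : ℝ)) ^ 2 *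
            (if x ∈ PT.ball (L ^ (j + 1) / 2) then (1 : ℝ) else 0)) * a := by rw [Finset.sum_mul]
      _ ≤ 4 * L ^ 6 * L ^ (6 * j) * a := mul_le_mul_of_nonneg_right (sum_l1_sq_ind_le S hL1 j) ha0
  have hLj : L ^ (4 * j) ≠ 0 := pow_ne_zero _ hL0.ne'
  have e6 : L ^ (6 * j) = L ^ (4 * j) * L ^ (2 * j) := by rw [← pow_add]; ring_nf
  calc (L ^ (4 * j))⁻¹ * (|∑ x ∈ S, (∑ i, ((x i : ℤ) : ℝ) ^ 2) * Gam 4 L s (j + 1) x| / 4)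
      ≤ (L ^ (4 * j))⁻¹ * (4 * L ^ 6 * L ^ (6 * j) * a / 4) := by gcongr
    _ = L ^ 6 * ((L ^ (4 * j))⁻¹ * L ^ (4 * j)) * L ^ (2 * j) * a := by rw [e6]; ring
    _ = L ^ 6 * L ^ (2 * j) * a := by rw [inv_mul_cancel₀ hLj, mul_one]

/-- **`|L²w̄_{j+1}^{(1)} - w̄_j^{(1)}| ≤ WL⁴` for all `j`, `m² ≥ 0`** (`L ≥ 2`).
[cite: BauerschmidtBrydgesSlade2015LogCorr, §6.1 ([BBS-rg-pt] Lemma 6.1.2)] -/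
theorem abs_wbarOneDiff_le : ∃ W : ℝ, 0 < W ∧ ∀ L : ℝ, 2 ≤ L → ∀ s : ℝ, 0 ≤ s → ∀ j : ℕ,
    |wbarOneDiff 4 L s j| ≤ W * L ^ 4 := by
  obtain ⟨c, hc, h⟩ := abs_Gam_four_le
  refine ⟨16 * c, by positivity, fun L hL s hs j => ?_⟩
  have hL0 : (0 : ℝ) < L := by linarith
  have hLj : L ^ (2 * j) ≠ 0 := pow_ne_zero _ hL0.ne'
  calc |wbarOneDiff 4 L s j| ≤ 16 * L ^ 4 * L ^ (2 * j) * (c / L ^ (2 * j)) :=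
        abs_wbarOneDiff_le_core hL hs j fun x => h L hL s hs j x
    _ = 16 * c * L ^ 4 := by field_simp

/-- **`|L²w̄_{j+1}^{(1)} - w̄_j^{(1)}| ≤ WL⁴ϑ_j(m²;p)` for `m² > 0`** (every `p`; `L ≥ 2`): the
combination decays beyond the mass scale like `C_{j+1}` itself.
[cite: BauerschmidtBrydgesSlade2015LogCorr, §6.1 and §5.2 (scaling estimate with (1+m²L^{2(j-1)})^{-k}); [BBS-rg-pt] Proposition 4.2.1 (ρ_pt = O((1+m²L^{2j})^{-k}|V|³))] -/
theorem abs_wbarOneDiff_le_decay (p : ℕ) : ∃ W : ℝ, 0 < W ∧ ∀ L : ℝ, 2 ≤ L → ∀ s : ℝ, 0 < s →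
    ∀ j : ℕ, |wbarOneDiff 4 L s j| ≤ W * L ^ 4 * ((1 + L ^ (2 * j) * s / (8 + s)) ^ p)⁻¹ := by
  obtain ⟨c, hc, h⟩ := abs_Gam_four_le_decay p
  refine ⟨16 * c, by positivity, fun L hL s hs j => ?_⟩
  have hL0 : (0 : ℝ) < L := by linarith
  have hLj : L ^ (2 * j) ≠ 0 := pow_ne_zero _ hL0.ne'
  calc |wbarOneDiff 4 L s j|
      ≤ 16 * L ^ 4 * L ^ (2 * j) * (c * ((1 + L ^ (2 * j) * s / (8 + s)) ^ p)⁻¹ / L ^ (2 * j)) :=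
        abs_wbarOneDiff_le_core hL hs.le j fun x => h L hL s hs j x
    _ = 16 * c * L ^ 4 * ((1 + L ^ (2 * j) * s / (8 + s)) ^ p)⁻¹ := by field_simp

/-- **`|L⁴w̄_{j+1}^{(**)} - w̄_j^{(**)}| ≤ WL⁶` for all `j`, `m² ≥ 0`** (`L ≥ 2`).
[cite: BauerschmidtBrydgesSlade2015LogCorr, §6.1 ([BBS-rg-pt] Lemma 6.1.2)] -/
theorem abs_wbarStarDiff_le : ∃ W : ℝ, 0 < W ∧ ∀ L : ℝ, 2 ≤ L → ∀ s : ℝ, 0 ≤ s → ∀ j : ℕ,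
    |wbarStarDiff 4 L s j| ≤ W * L ^ 6 := by
  obtain ⟨c, hc, h⟩ := abs_Gam_four_le
  refine ⟨c, hc, fun L hL s hs j => ?_⟩
  have hL0 : (0 : ℝ) < L := by linarith
  have hLj : L ^ (2 * j) ≠ 0 := pow_ne_zero _ hL0.ne'
  calc |wbarStarDiff 4 L s j| ≤ L ^ 6 * L ^ (2 * j) * (c / L ^ (2 * j)) :=
        abs_wbarStarDiff_le_core hL hs j fun x => h L hL s hs j x
    _ = c * L ^ 6 := by field_simp

/-- **`|L⁴w̄_{j+1}^{(**)} - w̄_j^{(**)}| ≤ WL⁶ϑ_j(m²;p)` for `m² > 0`** (every `p`; `L ≥ 2`).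
[cite: BauerschmidtBrydgesSlade2015LogCorr, §6.1 and §5.2; [BBS-rg-pt] Proposition 4.2.1] -/
theorem abs_wbarStarDiff_le_decay (p : ℕ) : ∃ W : ℝ, 0 < W ∧ ∀ L : ℝ, 2 ≤ L → ∀ s : ℝ, 0 < s →
    ∀ j : ℕ, |wbarStarDiff 4 L s j| ≤ W * L ^ 6 * ((1 + L ^ (2 * j) * s / (8 + s)) ^ p)⁻¹ := by
  obtain ⟨c, hc, h⟩ := abs_Gam_four_le_decay p
  refine ⟨c, hc, fun L hL s hs j => ?_⟩
  have hL0 : (0 : ℝ) < L := by linarith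
  have hLj : L ^ (2 * j) ≠ 0 := pow_ne_zero _ hL0.ne'
  calc |wbarStarDiff 4 L s j|
      ≤ L ^ 6 * L ^ (2 * j) * (c * ((1 + L ^ (2 * j) * s / (8 + s)) ^ p)⁻¹ / L ^ (2 * j)) :=
        abs_wbarStarDiff_le_core hL hs.le j fun x => h L hL s hs j x
    _ = c * L ^ 6 * ((1 + L ^ (2 * j) * s / (8 + s)) ^ p)⁻¹ := by field_simp

/-! ### The change of variables `T_j` -/

/-- **The transformation `T_j(g, z, μ) = (ǧ, ž, μ̌)`**: `ǧ = g + 4gμw̄_j^{(1)}`,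
`ž = z + 2zμw̄_j^{(1)} + ½μ²w̄_j^{(**)}`, `μ̌ = μ + μ²w̄_j^{(1)}` (`d = 4`; on `𝒱 = ℝ³` with `V 0 = g`,
`V 1 = z`, `V 2 = μ`). [cite: BauerschmidtBrydgesSlade2015LogCorr, §6.1 (T_j "defined in [BBS-rg-pt]": [BBS-rg-pt] §4.2, (gch-def1)–(much-def1))] -/
def Ttrans (L s : ℝ) (j : ℕ) (V : V3) : V3 :=
  ![V 0 + 4 * V 0 * V 2 * wbarOne 4 L s j,
    V 1 + 2 * V 1 * V 2 * wbarOne 4 L s j + 1 / 2 * V 2 ^ 2 * wbarStar 4 L s j,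
    V 2 + V 2 ^ 2 * wbarOne 4 L s j]

/-- `ǧ = g + 4gμw̄_j^{(1)}`. [cite: BauerschmidtBrydgesSlade2015LogCorr, §6.1 ([BBS-rg-pt] (gch-def1))] -/
@[simp] theorem Ttrans_apply_zero (L s : ℝ) (j : ℕ) (V : V3) :
    Ttrans L s j V 0 = V 0 + 4 * V 0 * V 2 * wbarOne 4 L s j := rfl

/-- `ž = z + 2zμw̄_j^{(1)} + ½μ²w̄_j^{(**)}`. [cite: BauerschmidtBrydgesSlade2015LogCorr, §6.1 ([BBS-rg-pt] (zch-def1))] -/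
@[simp] theorem Ttrans_apply_one (L s : ℝ) (j : ℕ) (V : V3) :
    Ttrans L s j V 1 = V 1 + 2 * V 1 * V 2 * wbarOne 4 L s j + 1 / 2 * V 2 ^ 2 * wbarStar 4 L s j := rfl

/-- `μ̌ = μ + μ²w̄_j^{(1)}`. [cite: BauerschmidtBrydgesSlade2015LogCorr, §6.1 ([BBS-rg-pt] (much-def1))] -/
@[simp] theorem Ttrans_apply_two (L s : ℝ) (j : ℕ) (V : V3) :
    Ttrans L s j V 2 = V 2 + V 2 ^ 2 * wbarOne 4 L s j := rfl

/-- **`T_0(V) = V`** (`w̄_0 = 0`). [cite: BauerschmidtBrydgesSlade2015LogCorr, §6.1 (display: T_0(V) = V)] -/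
theorem Ttrans_zero_scale (L s : ℝ) (V : V3) : Ttrans L s 0 V = V := by
  ext i
  fin_cases i <;> simp [Ttrans]

/-- `T_j(0) = 0`. [cite: BauerschmidtBrydgesSlade2015LogCorr, §6.1 (T_j(V) = V + O(‖V‖²))] -/
@[simp] theorem Ttrans_zero (L s : ℝ) (j : ℕ) : Ttrans L s j 0 = 0 := by
  ext i
  fin_cases i <;> simp [Ttrans]

/-- **`T_j(V) = V + O(‖V‖²)`, quantitatively**: if `|w̄_j^{(1)}|, |w̄_j^{(**)}| ≤ W` then
`‖T_j(V) - V‖ ≤ 4W‖V‖²` (sup norm on `ℝ³`). [cite: BauerschmidtBrydgesSlade2015LogCorr, §6.1 (display: T_j(V) = V + O(‖V‖²))] -/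
theorem norm_Ttrans_sub_self_le {L s : ℝ} {j : ℕ} {W : ℝ} (hw : |wbarOne 4 L s j| ≤ W)
    (hst : |wbarStar 4 L s j| ≤ W) (V : V3) : ‖Ttrans L s j V - V‖ ≤ 4 * W * ‖V‖ ^ 2 := by
  have hW : 0 ≤ W := (abs_nonneg _).trans hw
  have hV0 : 0 ≤ ‖V‖ := norm_nonneg _
  have hc : ∀ i, |V i| ≤ ‖V‖ := fun i => by rw [← Real.norm_eq_abs]; exact norm_le_pi_norm V i
  refine (pi_norm_le_iff_of_nonneg (by positivity)).2 fun i => ?_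
  rw [Pi.sub_apply, Real.norm_eq_abs]
  have h0 := hc 0; have h1 := hc 1; have h2 := hc 2
  fin_cases i
  · simp only [Fin.zero_eta, Ttrans_apply_zero, add_sub_cancel_left]
    rw [abs_mul, abs_mul, abs_mul, show |(4 : ℝ)| = 4 by norm_num]
    calc 4 * |V 0| * |V 2| * |wbarOne 4 L s j| ≤ 4 * ‖V‖ * ‖V‖ * W := by gcongr
      _ = 4 * W * ‖V‖ ^ 2 := by ring
  · simp only [Fin.mk_one, Ttrans_apply_one, add_assoc, add_sub_cancel_left]
    calc |2 * V 1 * V 2 * wbarOne 4 L s j + 1 / 2 * V 2 ^ 2 * wbarStar 4 L s j|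
        ≤ |2 * V 1 * V 2 * wbarOne 4 L s j| + |1 / 2 * V 2 ^ 2 * wbarStar 4 L s j| := abs_add_le _ _
      _ = 2 * |V 1| * |V 2| * |wbarOne 4 L s j| + 1 / 2 * |V 2| ^ 2 * |wbarStar 4 L s j| := by
          simp only [abs_mul, abs_pow, show |(2 : ℝ)| = 2 by norm_num,
            show |(1 / 2 : ℝ)| = 1 / 2 by norm_num]
      _ ≤ 2 * ‖V‖ * ‖V‖ * W + 1 / 2 * ‖V‖ ^ 2 * W := by gcongr
      _ ≤ 4 * W * ‖V‖ ^ 2 := by nlinarith [mul_nonneg hW (sq_nonneg ‖V‖)]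
  · simp only [Fin.reduceFinMk, Ttrans_apply_two, add_sub_cancel_left]
    rw [abs_mul, abs_pow]
    calc |V 2| ^ 2 * |wbarOne 4 L s j| ≤ ‖V‖ ^ 2 * W := by gcongr
      _ ≤ 4 * W * ‖V‖ ^ 2 := by nlinarith [mul_nonneg hW (sq_nonneg ‖V‖)]

/-- **BBS 2015, §6.1: `T_j(V) = V + O(‖V‖²)` with error estimate uniform in `j`** (and in `m² ≥ 0`),
for the explicit decomposition in `d = 4`, `L ≥ 2`: `‖T_j(V) - V‖ ≤ A‖V‖²` for all `j`, `m² ≥ 0`, `V`.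
[cite: BauerschmidtBrydgesSlade2015LogCorr, §6.1 (display: T_0(V) = V, T_j(V) = V + O(‖V‖²), "with error estimate uniform in j")] -/
theorem exists_norm_Ttrans_sub_self_le {L : ℝ} (hL : 2 ≤ L) : ∃ A : ℝ, 0 < A ∧ ∀ s : ℝ, 0 ≤ s →
    ∀ j : ℕ, ∀ V : V3, ‖Ttrans L s j V - V‖ ≤ A * ‖V‖ ^ 2 := by
  obtain ⟨W₁, hW₁, h₁⟩ := abs_wbarOne_le
  obtain ⟨W₂, hW₂, h₂⟩ := abs_wbarStar_le
  have hL1 : (1 : ℝ) ≤ L := by linarith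
  refine ⟨4 * (W₁ * L ^ 4 + W₂ * L ^ 6), by positivity, fun s hs j V => ?_⟩
  have hw : |wbarOne 4 L s j| ≤ W₁ * L ^ 4 + W₂ * L ^ 6 :=
    (h₁ L hL s hs j).trans (le_add_of_nonneg_right (by positivity))
  have hst : |wbarStar 4 L s j| ≤ W₁ * L ^ 4 + W₂ * L ^ 6 :=
    (h₂ L hL s hs j).trans (le_add_of_nonneg_left (by positivity))
  exact norm_Ttrans_sub_self_le hw hst V

/-! ### The perturbative map `φ_pt^{(0)}` -/

/-- **`μ₊ = L^{2(j+1)}ν₊ = L²μ + η_jg`** (`ν₊ = ν + η'g`, rescaled).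
[cite: BauerschmidtBrydgesSlade2015LogCorr, §6.1 ([BBS-rg-pt] §3.6 (nuplusdef) ν₊ = ν + η'g, §6.2 "Let μ₊ = L^{2(j+1)}ν₊")] -/
def muPlus (L s : ℝ) (j : ℕ) (V : V3) : ℝ := L ^ 2 * V 2 + etaPT 4 L s j * V 0

/-- **The perturbative flow `φ_{pt,j}^{(0)}(g, z, μ) = (g_pt, z_pt, μ_pt)` on `ℝ³`** (`d = 4`),
(newflow-g)–(newflow-mu) of [BBS-rg-pt] with the `δ`-terms written out as in its §6.2
(`μ₊ = L²μ + η_jg`, `w̄ = w̄_j`, `w̄₊ = w̄_{j+1}`):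
`g_pt = g - β_jg² - 4g(μ₊w̄₊^{(1)} - μw̄^{(1)})`,
`z_pt = z - θ_jg² - ½(μ₊²w̄₊^{(**)} - μ²w̄^{(**)}) - 2z(μ₊w̄₊^{(1)} - μw̄^{(1)})`,
`μ_pt = L²μ + η_j(g + 4gμw̄^{(1)}) - ξ_jg² - ω_jgμ - π_jgz - (μ₊²w̄₊^{(1)} - L²μ²w̄^{(1)})`.
[cite: BauerschmidtBrydgesSlade2015LogCorr, §6.1 ("an explicit quadratic map φ_{pt,j}^{(0)} : ℝ³ → ℝ³ is defined" in [BBS-rg-pt]: §4.2 (newflow-g)–(newflow-mu), §6.2 (newflow-g-mu)–(newflow-mu-mu))] -/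
def phiPT (L s : ℝ) (j : ℕ) (V : V3) : V3 :=
  ![V 0 - betaPT 4 L s j * V 0 ^ 2 -
      4 * V 0 * (muPlus L s j V * wbarOne 4 L s (j + 1) - V 2 * wbarOne 4 L s j),
    V 1 - thetaPT 4 L s j * V 0 ^ 2 -
      1 / 2 * (muPlus L s j V ^ 2 * wbarStar 4 L s (j + 1) - V 2 ^ 2 * wbarStar 4 L s j) -
      2 * V 1 * (muPlus L s j V * wbarOne 4 L s (j + 1) - V 2 * wbarOne 4 L s j),
    L ^ 2 * V 2 + etaPT 4 L s j * (V 0 + 4 * V 0 * V 2 * wbarOne 4 L s j) - xiPT 4 L s j * V 0 ^ 2 -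
      omegaPT 4 L s j * V 0 * V 2 - piPT 4 L s j * V 0 * V 1 -
      (muPlus L s j V ^ 2 * wbarOne 4 L s (j + 1) - L ^ 2 * V 2 ^ 2 * wbarOne 4 L s j)]

/-- `g_pt`. [cite: BauerschmidtBrydgesSlade2015LogCorr, §6.1 ([BBS-rg-pt] (newflow-g))] -/
@[simp] theorem phiPT_apply_zero (L s : ℝ) (j : ℕ) (V : V3) :
    phiPT L s j V 0 = V 0 - betaPT 4 L s j * V 0 ^ 2 -
      4 * V 0 * (muPlus L s j V * wbarOne 4 L s (j + 1) - V 2 * wbarOne 4 L s j) := rfl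

/-- `z_pt`. [cite: BauerschmidtBrydgesSlade2015LogCorr, §6.1 ([BBS-rg-pt] (newflow-z))] -/
@[simp] theorem phiPT_apply_one (L s : ℝ) (j : ℕ) (V : V3) :
    phiPT L s j V 1 = V 1 - thetaPT 4 L s j * V 0 ^ 2 -
      1 / 2 * (muPlus L s j V ^ 2 * wbarStar 4 L s (j + 1) - V 2 ^ 2 * wbarStar 4 L s j) -
      2 * V 1 * (muPlus L s j V * wbarOne 4 L s (j + 1) - V 2 * wbarOne 4 L s j) := rfl

/-- `μ_pt`. [cite: BauerschmidtBrydgesSlade2015LogCorr, §6.1 ([BBS-rg-pt] (newflow-mu))] -/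
@[simp] theorem phiPT_apply_two (L s : ℝ) (j : ℕ) (V : V3) :
    phiPT L s j V 2 = L ^ 2 * V 2 + etaPT 4 L s j * (V 0 + 4 * V 0 * V 2 * wbarOne 4 L s j) -
      xiPT 4 L s j * V 0 ^ 2 - omegaPT 4 L s j * V 0 * V 2 - piPT 4 L s j * V 0 * V 1 -
      (muPlus L s j V ^ 2 * wbarOne 4 L s (j + 1) - L ^ 2 * V 2 ^ 2 * wbarOne 4 L s j) := rfl

/-- **(newflow-g-mu):** `g_pt + 4gμ₊w̄_{j+1}^{(1)} = ǧ - β_jg²`.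
[cite: BauerschmidtBrydgesSlade2015LogCorr, §6.1 ([BBS-rg-pt] §6.2, display (newflow-g-mu))] -/
theorem phiPT_bracket_zero (L s : ℝ) (j : ℕ) (V : V3) :
    phiPT L s j V 0 + 4 * V 0 * muPlus L s j V * wbarOne 4 L s (j + 1) =
      Ttrans L s j V 0 - betaPT 4 L s j * V 0 ^ 2 := by
  simp only [phiPT_apply_zero, Ttrans_apply_zero]
  ring

/-- **(newflow-z-mu):** `z_pt + 2zμ₊w̄_{j+1}^{(1)} + ½μ₊²w̄_{j+1}^{(**)} = ž - θ_jg²`.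
[cite: BauerschmidtBrydgesSlade2015LogCorr, §6.1 ([BBS-rg-pt] §6.2, display (newflow-z-mu))] -/
theorem phiPT_bracket_one (L s : ℝ) (j : ℕ) (V : V3) :
    phiPT L s j V 1 + 2 * V 1 * muPlus L s j V * wbarOne 4 L s (j + 1) +
        1 / 2 * muPlus L s j V ^ 2 * wbarStar 4 L s (j + 1) =
      Ttrans L s j V 1 - thetaPT 4 L s j * V 0 ^ 2 := by
  simp only [phiPT_apply_one, Ttrans_apply_one]
  ring

/-- **(newflow-mu-mu):** `μ_pt + μ₊²w̄_{j+1}^{(1)} = L²μ̌ + η_jǧ - ξ_jg² - ω_jgμ - π_jgz`.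
[cite: BauerschmidtBrydgesSlade2015LogCorr, §6.1 ([BBS-rg-pt] §6.2, display (newflow-mu-mu))] -/
theorem phiPT_bracket_two (L s : ℝ) (j : ℕ) (V : V3) :
    phiPT L s j V 2 + muPlus L s j V ^ 2 * wbarOne 4 L s (j + 1) =
      L ^ 2 * Ttrans L s j V 2 + etaPT 4 L s j * Ttrans L s j V 0 - xiPT 4 L s j * V 0 ^ 2 -
        omegaPT 4 L s j * V 0 * V 2 - piPT 4 L s j * V 0 * V 1 := by
  simp only [phiPT_apply_two, Ttrans_apply_two, Ttrans_apply_zero]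
  ring

/-- **The unrescaled bulk flow equations** (gpt2a), (nupta), (zpta) of [BBS-rg-pt] for
`V = gτ² + ντ + zτ_Δ` (`y = 0`, `z = z^{(0)}`), with `C = C_{j+1}`, `w = w_j`, `η' = 2C_{0,0}`,
`ν₊ = ν + η'g`, `w₊ = w + C`, `δ[f(ν,w)] = f(ν₊,w₊) - f(ν,w)`, `w^{(1)} = Σ_xw_x`:
`g_pt = g - βg² - 4gδ[νw^{(1)}]`, `ν_pt = ν + η'(g + 4gνw^{(1)}) - ξ'g² - ¼βgν - π'gz - δ[ν²w^{(1)}]`,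
`z_pt = z - θg² - ½δ[ν²w^{(**)}] - 2zδ[νw^{(1)}]` — as a map `(g, z, ν) ↦ (g_pt, z_pt, ν_pt)`.
[cite: BauerschmidtBrydgesSlade2015LogCorr, §6.1 ([BBS-rg-pt] §3.6 (nuplusdef), (delta-def); §4.1 (gpt2a), (nupta), (zpta))] -/
def phiPTnu (L s : ℝ) (j : ℕ) (U : V3) : V3 :=
  ![U 0 - betaPT 4 L s j * U 0 ^ 2 -
      4 * U 0 * ((U 2 + etaPrimePT 4 L s j * U 0) * ∑' x : Site 4, covSum 4 L s (j + 1) x -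
        U 2 * ∑' x : Site 4, covSum 4 L s j x),
    U 1 - thetaPT 4 L s j * U 0 ^ 2 -
      1 / 2 * ((U 2 + etaPrimePT 4 L s j * U 0) ^ 2 * starSum (covSum 4 L s (j + 1)) -
        U 2 ^ 2 * starSum (covSum 4 L s j)) -
      2 * U 1 * ((U 2 + etaPrimePT 4 L s j * U 0) * ∑' x : Site 4, covSum 4 L s (j + 1) x -
        U 2 * ∑' x : Site 4, covSum 4 L s j x),
    U 2 + etaPrimePT 4 L s j * (U 0 + 4 * U 0 * U 2 * ∑' x : Site 4, covSum 4 L s j x) -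
      xiPrimePT 4 L s j * U 0 ^ 2 - 1 / 4 * betaPT 4 L s j * U 0 * U 2 - piPrimePT 4 L s j * U 0 * U 1 -
      ((U 2 + etaPrimePT 4 L s j * U 0) ^ 2 * ∑' x : Site 4, covSum 4 L s (j + 1) x -
        U 2 ^ 2 * ∑' x : Site 4, covSum 4 L s j x)]

/-- **`φ_pt^{(0)}` is the rescaling of the unrescaled flow**: with `μ = L^{2j}ν`,
`φ_{pt,j}^{(0)}(g, z, L^{2j}ν) = (g_pt, z_pt, L^{2(j+1)}ν_pt)` (`L ≠ 0`) — the content of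
"`V_pt^{(0)} = g_ptτ² + μ_ptL^{-2(j+1)}τ + z_pt^{(0)}τ_Δ` … In view of (gpt2a)–(zpta), this leads us to
consider the equations (newflow-g)–(newflow-mu)".
[cite: BauerschmidtBrydgesSlade2015LogCorr, §6.1 ([BBS-rg-pt] §4.2 (munu), (wbardef1)–(wbardef2), (Vpt0def))] -/
theorem phiPT_rescale {L : ℝ} (hL : L ≠ 0) (s : ℝ) (j : ℕ) (g z ν : ℝ) :
    phiPT L s j ![g, z, L ^ (2 * j) * ν] =
      ![phiPTnu L s j ![g, z, ν] 0, phiPTnu L s j ![g, z, ν] 1,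
        L ^ (2 * (j + 1)) * phiPTnu L s j ![g, z, ν] 2] := by
  have hLj : L ^ (2 * j) ≠ 0 := pow_ne_zero _ hL
  have hLj1 : L ^ (2 * (j + 1)) ≠ 0 := pow_ne_zero _ hL
  have hLj4 : L ^ (4 * j) ≠ 0 := pow_ne_zero _ hL
  have hLj41 : L ^ (4 * (j + 1)) ≠ 0 := pow_ne_zero _ hL
  -- the rescaled quantities in terms of the unrescaled ones
  have hw0 : wbarOne 4 L s j = (L ^ (2 * j))⁻¹ * ∑' x : Site 4, covSum 4 L s j x := rfl
  have hw1 : wbarOne 4 L s (j + 1) = (L ^ (2 * (j + 1)))⁻¹ * ∑' x : Site 4, covSum 4 L s (j + 1) x := rfl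
  have hs0 : wbarStar 4 L s j = (L ^ (4 * j))⁻¹ * starSum (covSum 4 L s j) := rfl
  have hs1 : wbarStar 4 L s (j + 1) = (L ^ (4 * (j + 1)))⁻¹ * starSum (covSum 4 L s (j + 1)) := rfl
  have hη : etaPT 4 L s j = L ^ (2 * (j + 1)) * etaPrimePT 4 L s j := rfl
  have hξ : xiPT 4 L s j = L ^ (2 * (j + 1)) * xiPrimePT 4 L s j := rfl
  have hπ : piPT 4 L s j = L ^ (2 * (j + 1)) * piPrimePT 4 L s j := rfl
  have hω : omegaPT 4 L s j = L ^ 2 * (1 / 4) * betaPT 4 L s j := rfl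
  have e21 : L ^ (2 * (j + 1)) = L ^ (2 * j) * L ^ 2 := by ring
  have e4 : L ^ (4 * j) = L ^ (2 * j) * L ^ (2 * j) := by ring
  have e41 : L ^ (4 * (j + 1)) = L ^ (2 * j) * L ^ (2 * j) * L ^ 2 * L ^ 2 := by ring
  ext i
  fin_cases i
  · simp only [Fin.zero_eta, phiPT_apply_zero, muPlus, Matrix.cons_val_zero, Matrix.cons_val_two,
      Matrix.tail_cons, Matrix.head_cons, phiPTnu, hw0, hw1, hη]
    rw [e21]
    field_simp
  · simp only [Fin.mk_one, phiPT_apply_one, muPlus, Matrix.cons_val_zero, Matrix.cons_val_one,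
      Matrix.cons_val_two, Matrix.tail_cons, Matrix.head_cons, phiPTnu, hw0, hw1, hs0, hs1, hη]
    rw [e41, e21, e4]
    field_simp
  · simp only [Fin.reduceFinMk, phiPT_apply_two, muPlus, Matrix.cons_val_zero, Matrix.cons_val_one,
      Matrix.cons_val_two, Matrix.tail_cons, Matrix.head_cons, phiPTnu, hw0, hw1, hη, hξ, hπ, hω]
    rw [e21]
    field_simp

/-! ### `ρ̃_j = T_{j+1} ∘ φ_pt^{(0)} - φ̄_j ∘ T_j`: the second-order cancellation -/

/-- **`ρ̃_j(V) = T_{j+1}(φ_{pt,j}^{(0)}(V)) - φ̄_j(T_j(V))`** with `φ̄_j = (wsawQuadFlow L m²).map j`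
(so that `ρ_{pt,j} = ρ̃_j ∘ T_j⁻¹` in the notation of [BBS-rg-pt, Proposition 4.2.1]).
[cite: BauerschmidtBrydgesSlade2015LogCorr, §6.1 ("The composite maps T_{j+1} ∘ φ_{pt,j}^{(0)} ∘ T_j⁻¹ are equal, up to an error O(‖V‖³), to φ̄_j"; [BBS-rg-pt] Proposition 4.2.1, (Tcomp))] -/
def rhoPT (L s : ℝ) (j : ℕ) (V : V3) : V3 :=
  Ttrans L s (j + 1) (phiPT L s j V) - (wsawQuadFlow L s).map j (Ttrans L s j V)

/-- **Second-order cancellation, `g`-row**: with `μ₊ = L²μ + η_jg`, `D₁ = L²w̄_{j+1}^{(1)} - w̄_j^{(1)}`,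
`ρ̃_j(V)_g = β_j(ǧ² - g²) + 4w̄_{j+1}^{(1)}[(g_pt - g)μ_pt + g(μ_pt - μ₊)]`, where
`ǧ² - g² = 4gμw̄_j^{(1)}(2g + 4gμw̄_j^{(1)})`, `g_pt - g = -(β_jg² + 4g(μD₁ + η_jgw̄_{j+1}^{(1)}))`,
`μ_pt - μ₊ = -L²μ²D₁ - η_j(2L²gμ + η_jg²)w̄_{j+1}^{(1)} + (4η_jgμw̄_j^{(1)} - ξ_jg² - ω_jgμ - π_jgz)` —
cubic in `(g, z, μ)`, each monomial carrying a decaying factor.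
[cite: BauerschmidtBrydgesSlade2015LogCorr, §6.1 ([BBS-rg-pt] §6.2, the display computing g_pt + 4gμ₊w̄_{j+1}^{(1)} = ǧ_pt + O(|V|³))] -/
theorem rhoPT_apply_zero (L s : ℝ) (j : ℕ) (V : V3) :
    rhoPT L s j V 0 =
      betaPT 4 L s j * (4 * V 0 * V 2 * wbarOne 4 L s j * (2 * V 0 + 4 * V 0 * V 2 * wbarOne 4 L s j)) +
      4 * wbarOne 4 L s (j + 1) *
        (-(betaPT 4 L s j * V 0 ^ 2 +
            4 * V 0 * (V 2 * wbarOneDiff 4 L s j + etaPT 4 L s j * V 0 * wbarOne 4 L s (j + 1))) *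
          phiPT L s j V 2 +
        V 0 * (-(L ^ 2 * V 2 ^ 2 * wbarOneDiff 4 L s j) -
          etaPT 4 L s j * (2 * L ^ 2 * V 0 * V 2 + etaPT 4 L s j * V 0 ^ 2) * wbarOne 4 L s (j + 1) +
          (4 * etaPT 4 L s j * V 0 * V 2 * wbarOne 4 L s j - xiPT 4 L s j * V 0 ^ 2 -
            omegaPT 4 L s j * V 0 * V 2 - piPT 4 L s j * V 0 * V 1))) := by
  simp only [rhoPT, Pi.sub_apply, Ttrans_apply_zero, phiPT_apply_zero, phiPT_apply_two, muPlus,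
    QuadFlowParams.map_apply_zero, wbarOneDiff]
  simp only [wsawQuadFlow]
  ring

/-- **Second-order cancellation, `z`-row**: with `D₂ = L⁴w̄_{j+1}^{(**)} - w̄_j^{(**)}`,
`ρ̃_j(V)_z = θ_j(ǧ² - g²) + 2w̄_{j+1}^{(1)}[(z_pt - z)μ_pt + z(μ_pt - μ₊)] + ½w̄_{j+1}^{(**)}(μ_pt - μ₊)(μ_pt + μ₊)`,
`z_pt - z = -(2z(μD₁ + η_jgw̄_{j+1}^{(1)}) + ½(μ²D₂ + η_j(2L²gμ + η_jg²)w̄_{j+1}^{(**)}) + θ_jg²)`.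
[cite: BauerschmidtBrydgesSlade2015LogCorr, §6.1 ([BBS-rg-pt] §6.2, proof of Proposition 4.2.1)] -/
theorem rhoPT_apply_one (L s : ℝ) (j : ℕ) (V : V3) :
    rhoPT L s j V 1 =
      thetaPT 4 L s j * (4 * V 0 * V 2 * wbarOne 4 L s j * (2 * V 0 + 4 * V 0 * V 2 * wbarOne 4 L s j)) +
      2 * wbarOne 4 L s (j + 1) *
        (-(2 * V 1 * (V 2 * wbarOneDiff 4 L s j + etaPT 4 L s j * V 0 * wbarOne 4 L s (j + 1)) +
            1 / 2 * (V 2 ^ 2 * wbarStarDiff 4 L s j +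
              etaPT 4 L s j * (2 * L ^ 2 * V 0 * V 2 + etaPT 4 L s j * V 0 ^ 2) *
                wbarStar 4 L s (j + 1)) +
            thetaPT 4 L s j * V 0 ^ 2) * phiPT L s j V 2 +
        V 1 * (-(L ^ 2 * V 2 ^ 2 * wbarOneDiff 4 L s j) -
          etaPT 4 L s j * (2 * L ^ 2 * V 0 * V 2 + etaPT 4 L s j * V 0 ^ 2) * wbarOne 4 L s (j + 1) +
          (4 * etaPT 4 L s j * V 0 * V 2 * wbarOne 4 L s j - xiPT 4 L s j * V 0 ^ 2 -
            omegaPT 4 L s j * V 0 * V 2 - piPT 4 L s j * V 0 * V 1))) +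
      1 / 2 * wbarStar 4 L s (j + 1) *
        ((-(L ^ 2 * V 2 ^ 2 * wbarOneDiff 4 L s j) -
          etaPT 4 L s j * (2 * L ^ 2 * V 0 * V 2 + etaPT 4 L s j * V 0 ^ 2) * wbarOne 4 L s (j + 1) +
          (4 * etaPT 4 L s j * V 0 * V 2 * wbarOne 4 L s j - xiPT 4 L s j * V 0 ^ 2 -
            omegaPT 4 L s j * V 0 * V 2 - piPT 4 L s j * V 0 * V 1)) *
          (phiPT L s j V 2 + muPlus L s j V)) := by
  simp only [rhoPT, Pi.sub_apply, Ttrans_apply_one, Ttrans_apply_zero, phiPT_apply_one,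
    phiPT_apply_two, muPlus, QuadFlowParams.map_apply_one, wbarOneDiff, wbarStarDiff]
  simp only [wsawQuadFlow]
  ring

/-- **Second-order cancellation, `μ`-row**:
`ρ̃_j(V)_μ = w̄_{j+1}^{(1)}(μ_pt - μ₊)(μ_pt + μ₊) + ξ_j(ǧ² - g²) + ω_j(ǧμ̌ - gμ) + π_j(ǧž - gz)`,
`ǧμ̌ - gμ = 4gμw̄_j^{(1)}μ̌ + gμ²w̄_j^{(1)}`, `ǧž - gz = 4gμw̄_j^{(1)}ž + g(2zμw̄_j^{(1)} + ½μ²w̄_j^{(**)})`.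
[cite: BauerschmidtBrydgesSlade2015LogCorr, §6.1 ([BBS-rg-pt] §6.2, proof of Proposition 4.2.1)] -/
theorem rhoPT_apply_two (L s : ℝ) (j : ℕ) (V : V3) :
    rhoPT L s j V 2 =
      wbarOne 4 L s (j + 1) *
        ((-(L ^ 2 * V 2 ^ 2 * wbarOneDiff 4 L s j) -
          etaPT 4 L s j * (2 * L ^ 2 * V 0 * V 2 + etaPT 4 L s j * V 0 ^ 2) * wbarOne 4 L s (j + 1) +
          (4 * etaPT 4 L s j * V 0 * V 2 * wbarOne 4 L s j - xiPT 4 L s j * V 0 ^ 2 -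
            omegaPT 4 L s j * V 0 * V 2 - piPT 4 L s j * V 0 * V 1)) *
          (phiPT L s j V 2 + muPlus L s j V)) +
      xiPT 4 L s j * (4 * V 0 * V 2 * wbarOne 4 L s j * (2 * V 0 + 4 * V 0 * V 2 * wbarOne 4 L s j)) +
      omegaPT 4 L s j * (4 * V 0 * V 2 * wbarOne 4 L s j * Ttrans L s j V 2 +
        V 0 * (V 2 ^ 2 * wbarOne 4 L s j)) +
      piPT 4 L s j * (4 * V 0 * V 2 * wbarOne 4 L s j * Ttrans L s j V 1 +
        V 0 * (2 * V 1 * V 2 * wbarOne 4 L s j + 1 / 2 * V 2 ^ 2 * wbarStar 4 L s j)) := by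
  simp only [rhoPT, Pi.sub_apply, Ttrans_apply_two, Ttrans_apply_one, Ttrans_apply_zero, phiPT_apply_two,
    muPlus, QuadFlowParams.map_apply_two, wbarOneDiff]
  simp only [wsawQuadFlow]
  ring

end CTWSAW

end Literature.Barriers.CriticalPhenomena
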